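import Literature.Analysis.UnboundedOperators.SemigroupLaplaceResolventIdentity
import Literature.Analysis.UnboundedOperators.StrongContRepresentationDerivProofs
import Mathlib.Analysis.Calculus.MeanValue
import HarnessLib

/-!
# Eigenvectors of the generator: `A x = μ x ⟹ T(t) x = e^{μt} x ⟹ R(λ) x = (λ − μ)⁻¹ x`
  (Engel–Nagel II Lemma 1.3 / IV-§3 point spectrum; the generator end of the Laplace bridge)

Analysis/UnboundedOperators proofs-layer file (theorems only, no definitions, no named facts),
closing the chain `generator eigenvector → semigroup eigenvector → resolvent eigenvector → Riesz
projection non-trivial` for the C₀-semigroups of the tree: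

* `app_eq_exp_smul_of_generator_eq`: if `x ∈ D(A)` and `A x = μ x` then `T(t) x = e^{μt} x` for
  all `t ≥ 0` (Engel–Nagel Ch. II Lemma 1.3 (ii) `d/dt T(t)x = T(t)Ax`, so
  `d/dt [e^{−μt} T(t) x] = 0` on `[0,∞)`; constancy by the one-sided mean value theorem
  `constant_of_has_deriv_right_zero`), i.e. the elementary inclusion
  `e^{tσ_p(A)} ⊆ σ_p(T(t))` of the spectral mapping theorem for the point spectrum
  (Engel–Nagel Ch. IV Thm. 3.7);
* `laplaceResolvent_apply_of_generator_eq`: hence `R(λ) x = (λ − μ)⁻¹ x` for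
  `Re λ > max(ω, Re μ)`, where `R = laplaceResolvent T hM` is the pseudo-resolvent of
  `SemigroupLaplaceResolventIdentity.lean`.

## References

* K.-J. Engel, R. Nagel, *One-Parameter Semigroups for Linear Evolution Equations* (2000),
  Ch. II Lemma 1.3 (ii), Ch. IV Thm. 3.7 (spectral mapping for the point spectrum).
  [EngelNagel2000]
-/

noncomputable section

open MeasureTheory Set Filter Topology Complex
open scoped NNReal

namespace Literature.Analysis.UnboundedOperators

namespace C0Semigroup

variable {E : Type*} [NormedAddCommGroup E] [NormedSpace ℂ E] [CompleteSpace E]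

/-- **Generator eigenvectors are semigroup eigenvectors**: `x ∈ D(A)`, `A x = μ x ⟹
T(t) x = e^{μt} x` for all `t ≥ 0`. [cite: EngelNagel2000, Ch. II Lemma 1.3 (ii) and Ch. IV Thm. 3.7] -/
theorem app_eq_exp_smul_of_generator_eq (T : C0Semigroup ℂ E) (x : T.generator.domain) {μ : ℂ}
    (hx : T.generator x = μ • (x : E)) (t : ℝ≥0) :
    T.app t (x : E) = Complex.exp (μ * (t : ℝ)) • (x : E) := by
  -- `ψ(s) = e^{−μs} T(s) x` has right derivative `0` on `[0, ∞)`
  set ψ : ℝ → E := fun s => Complex.exp (-(μ * s)) • T.app s.toNNReal (x : E) with hψ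
  have hderiv : ∀ s : ℝ, 0 ≤ s → HasDerivWithinAt ψ 0 (Ici s) s := by
    intro s hs
    have horb : HasDerivWithinAt (fun s : ℝ => T.app s.toNNReal (x : E))
        (T.app s.toNNReal (T.generator x)) (Ici s) s := by
      have h := T.hasDerivWithinAt_Ici_zero_app_of_mem x s.toNNReal
      rw [Real.coe_toNNReal s hs] at h
      exact h.mono (Ici_subset_Ici.2 hs)
    have hexp : HasDerivAt (fun s : ℝ => Complex.exp (-(μ * s)))
        (-μ * Complex.exp (-(μ * s))) s := by
      have h1 : HasDerivAt (fun y : ℂ => Complex.exp (-(μ * y)))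
          (Complex.exp (-(μ * s)) * (-(μ * 1))) (s : ℂ) :=
        (Complex.hasDerivAt_exp _).comp (s : ℂ) (((hasDerivAt_id (s : ℂ)).const_mul μ).neg)
      have h2 := h1.comp_ofReal
      convert h2 using 1
      ring
    have h := hexp.hasDerivWithinAt.smul horb
    rw [hx, map_smul] at h
    convert h using 1
    · funext s; rfl
    · rw [smul_smul, ← add_smul]
      rw [show Complex.exp (-(μ * (s : ℂ))) * μ + -μ * Complex.exp (-(μ * (s : ℂ))) = 0 by ring,
        zero_smul]
  -- constancy on every `[0, b]`
  have hconst : ∀ b : ℝ, 0 ≤ b → ψ b = ψ 0 := by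
    intro b hb
    have hcont : ContinuousOn ψ (Icc 0 b) := (continuous_integrand T μ (x : E)).continuousOn
    exact constant_of_has_deriv_right_zero hcont (fun s hs => hderiv s hs.1) b
      ⟨hb, le_rfl⟩
  have h0 : ψ 0 = (x : E) := by
    simp [hψ]
  have hb := hconst (t : ℝ) t.coe_nonneg
  rw [h0] at hb
  simp only [hψ, Real.toNNReal_coe] at hb
  -- `e^{−μt} T(t) x = x ⟹ T(t) x = e^{μt} x`
  have h := congrArg (fun v => Complex.exp (μ * (t : ℝ)) • v) hb
  simp only [smul_smul, ← Complex.exp_add] at h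
  rw [show μ * (t : ℝ) + -(μ * (t : ℝ)) = 0 by ring, Complex.exp_zero, one_smul] at h
  exact h

/-- **… hence resolvent eigenvectors of the Laplace-transform pseudo-resolvent**:
`A x = μ x ⟹ R(λ) x = (λ − μ)⁻¹ x` for `Re λ > max(ω, Re μ)` (`R = laplaceResolvent T hM`).
With `x ≠ 0` and a circle in `{Re > ω}` around `μ`, `IsPseudoResolvent.circleIntegral_ne_zero_of_apply_eq_inv_smul`
then makes the Riesz integral of `R` non-zero. [cite: EngelNagel2000, Ch. II Thm. 1.10 and Ch. IV Thm. 3.7] -/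
theorem laplaceResolvent_apply_of_generator_eq (T : C0Semigroup ℂ E) {M ω : ℝ}
    (hM : ∀ t : ℝ≥0, ‖T.app t‖ ≤ M * Real.exp (ω * t)) (x : T.generator.domain) {μ : ℂ}
    (hx : T.generator x = μ • (x : E)) {l : ℂ} (hl : ω < l.re) (hμl : μ.re < l.re) :
    T.laplaceResolvent hM l (x : E) = (l - μ)⁻¹ • (x : E) :=
  laplaceResolvent_apply_of_app_eq_exp_smul T hM (app_eq_exp_smul_of_generator_eq T x hx) hl hμl

end C0Semigroup

end Literature.Analysis.UnboundedOperators
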